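import Summits.ResolutionOfSingularities.ResolutionOfSingularities.Theorems.FrobeniusClosingPatchingRelPerfectCuspDepthFourPersistence
import HarnessLib

/-!
# Crux `PatchingRelPerfect` (stmt-ResolutionOfSingularities-16161), chain w52 — kernel certificate of
# the NON-GRADED DEPTH-FOUR member `(x₃² + x₀³) + 𝔪⁶`, part 2d: the ring-level tower theorem with
# the WEAK hypothesis on `t` modulo `c`

[OURS · L1 W5.2 · kernel (iii) beyond F6, CHAIN v2.0 §1 (C)] Part 2c (`…CuspDepthFourPersistence.lean`,
p535249) assumed `(t̄, ā)` weakly regular in `R/(c)`; its proof uses only that `t̄` is a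
non-zero-divisor of `R/(c)`.  This sibling states the tower theorem with exactly that hypothesis
(`isRegular_aChart'`, `depthFour_isRegular'`), which is what the `S`-level assembly (part 3b) has
cheaply on the `y`-charts of `Bl_𝔪 Spec S` (`u ∉ (z/y)`, `ConeRung.strictExc_notMem_of_chartBase_eq`).
Same proof as part 2c otherwise (note `NONGRADED-DEPTH4-MEMBER.md`, evidence #59).  FORMAT evidence for
the core on the `𝔪`-primary stratum; nothing here is a statement of the manuscript under review.

## References

* The Stacks Project, Tags 0804, 080A, 0BIQ. [StacksProject]
* U. Görtz, T. Wedhorn, *Algebraic Geometry I*, 2nd ed. 2020, Prop. 13.96 (2). [GortzWedhorn2020]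
* Q. Liu, *Algebraic Geometry and Arithmetic Curves*, OUP 2002, Thm. 8.1.19 (a). [Liu2002]
-/

-- `Summit.<Summit>.<Sub>.Theorems` with `Sub = Summit` (single-conjunct summit, D-0017)
set_option linter.dupNamespace false

noncomputable section

open CategoryTheory CategoryTheory.Limits AlgebraicGeometry Literature.AlgebraicGeometry.Resolution
open scoped Pointwise nonZeroDivisors

namespace Summit.ResolutionOfSingularities.ResolutionOfSingularities.Theorems

universe u

namespace CuspDepthFour
/-! ## Persistence on the `a`-chart and the ring-level tower theorem -/

section Persistence

variable {R : Type u} [CommRing R] (t c a : R)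

local notation3 "xx" => (![t, c, a] : Fin 3 → R)
/-- `J = {c}`: the complement `{t, a}` is indexed by `Fin 2`, the chart index `a` is `embc 1`. -/
local notation3 "embc" => (![(0 : Fin 3), 2] : Fin 2 → Fin 3)
/-- `J = {c}` as a sub-family of the indices `≠ 2`. -/
local notation3 "jJc" => (fun _ : Fin 1 => (⟨1, of_decide_eq_true rfl⟩ : {j : Fin 3 // j ≠ embc 1}))
/-- The notation of part 1 for the two products. -/
local notation3 "Pf[" t "," c "," a "]" => (Ideal.span {a ^ 2} ⊔ Ideal.span {c} ⊔ Ideal.span {t ^ 2})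
local notation3 "Sf[" t "," c "," a "]" => (Ideal.span {c} ⊔ Ideal.span {t * a} ⊔ Ideal.span {t ^ 2})
local notation3 "Kf[" t "," c "," a "]" => (Ideal.span {c ^ 2 + t * a ^ 3} ⊔ Ideal.span {t ^ 4})
local notation3 "Bf[" t "," c "," a "," k "]" =>
  (Ideal.span {a ^ (2 * k) * (c ^ 2 + t * a ^ 3)} ⊔ Ideal.span {c ^ (k + 2)} ⊔ Ideal.span {t ^ (2 * k + 4)})
local notation3 "Ff[" t "," c "," a "]" =>
  (Pf[t,c,a] * Sf[t,c,a] * Kf[t,c,a] * ∏ k ∈ Finset.range 6, Bf[t,c,a,k])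
local notation3 "Pa[" t "," c "," a "]" => (Ideal.span {a} ⊔ Ideal.span {c})
local notation3 "Sa[" t "," c "," a "]" => (Ideal.span {c} ⊔ Ideal.span {a * t})
local notation3 "Ka[" t "," c "," a "]" => (Ideal.span {c ^ 2 + t * a ^ 2} ⊔ Ideal.span {a ^ 2 * t ^ 4})
local notation3 "Ba[" t "," c "," a "," k "]" =>
  (Ideal.span {a ^ k * (c ^ 2 + t * a ^ 2)} ⊔ Ideal.span {c ^ (k + 2)} ⊔ Ideal.span {a ^ (k + 2) * t ^ (2 * k + 4)})
local notation3 "Fa[" t "," c "," a "]" =>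
  (Pa[t,c,a] * Sa[t,c,a] * Ka[t,c,a] * ∏ k ∈ Finset.range 6, Ba[t,c,a,k])

set_option maxHeartbeats 800000 in
-- strict-transform transports through bijective ring maps of `HomogeneousLocalization` charts
/-- **PERSISTENCE THROUGH THE SURFACE STEP, and the `a`-chart of the tower.**  For `R` a regular
domain, `(t, c, a)` weakly regular with `R/(t,c,a)`, `R/(t,c)` regular, and the strict transform of
`V(c)` controlled by: `R/(c)` a domain, `t̄` and `ā`
non-zero-divisors of `R/(c)`, `c ≠ 0` — every blowing up of the `a`-chart `B` of
`Bl_{(t,c,a)} Spec R` along the residual `F′(t/a, c/a, a/1)` is regular: the surface step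
(`isRegular_of_isBlowup_surfaceStep`, part 2a) applies because on the `a`-chart `B₀` of
`Bl_{(a, c′)} Spec B` one has `B₀/(c″) ≅ B/(c′)` (strict transform of `V(c′)` + principal Rees
chart), whence `B₀/(t′, c″) ≅ B/(t′, c′)` is regular (`CuspMember.lineHyp_aChart`) and
`(c″, t′)` is weakly regular (`t̄′ ≠ 0` in the domain `B/(c′)`).
[cite: GortzWedhorn2020, Prop. 13.96 (2)] [cite: StacksProject, Tag 0BIQ] [cite: Liu2002, Thm. 8.1.19 (a)] -/
theorem isRegular_aChart' [IsRegularRing R] [IsDomain R]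
    (hw : RingTheory.Sequence.IsWeaklyRegular R [t, c, a])
    (h3 : IsRegularRing (R ⧸ (Ideal.span {t} ⊔ Ideal.span {c} ⊔ Ideal.span {a})))
    (h2 : IsRegularRing (R ⧸ (Ideal.span {t} ⊔ Ideal.span {c})))
    (hcD : IsDomain (R ⧸ Ideal.span {c}))
    (hct : Ideal.Quotient.mk (Ideal.span {c}) t ∈ (R ⧸ Ideal.span {c})⁰)
    (hca : Ideal.Quotient.mk (Ideal.span {c}) a ∈ (R ⧸ Ideal.span {c})⁰) (hc0 : c ≠ 0)
    (Y : Scheme.{u}) (ρ : Y ⟶ Spec (.of (chartRing xx 2)))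
    (hρ : IsBlowup ρ (affineBlowup.idealSheaf (Fa[chartGen xx 2 0, chartGen xx 2 1, chartBase xx 2 a]))) :
    Scheme.IsRegular Y := by
  have hx : IsQuasiRegular xx := CuspMember.isQuasiRegular_vec3 hw
  obtain ⟨hB, hw', -, h2'⟩ := CuspMember.lineHyp_aChart t c a hw h3 h2
  haveI := hB
  haveI hRx : IsRegularRing (R ⧸ Ideal.span (Set.range xx)) := by
    rw [CuspMember.span_range_vec3]; exact h3
  -- letters on the `a`-chart `B`
  have cb_c : chartBase xx 2 c = chartBase xx 2 a * chartGen xx 2 1 :=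
    reesChartBase_apply_eq_mul_chartGen xx 2 1
  have ha0 : a ≠ 0 := by
    rintro rfl
    exact (nonZeroDivisors.ne_zero hca) (map_zero _)
  haveI hBdom : IsDomain (chartRing xx 2) := isDomain_chartRing xx 2 ha0
  haveI : NoZeroDivisors (chartRing xx 2) := IsDomain.to_noZeroDivisors (chartRing xx 2)
  have hAz : chartBase xx 2 a ∈ (chartRing xx 2)⁰ :=
    reesChartBase_mem_nonZeroDivisors (xx 2) (Ideal.mem_span_range_self (f := xx) (x := 2))
  have hA0 : chartBase xx 2 a ≠ 0 := nonZeroDivisors.ne_zero hAz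
  have hC'0 : chartGen xx 2 1 ≠ 0 := by
    intro h0
    have hcz : chartBase xx 2 c ∈ (chartRing xx 2)⁰ :=
      reesChartBase_mem_nonZeroDivisors_of_mem_nonZeroDivisors (I := Ideal.span (Set.range xx)) (xx 2)
        (Ideal.mem_span_range_self (f := xx) (x := 2)) (mem_nonZeroDivisors_of_ne_zero hc0)
    exact nonZeroDivisors.ne_zero hcz (by rw [cb_c, h0]; exact mul_zero (chartBase xx 2 a))
  -- the centre `(a, c′)` of the surface step as a chart family
  let jJy : Fin 1 → {j : Fin 3 // j ≠ 2} := fun _ => ⟨1, by decide⟩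
  have hjJy : Function.Injective jJy := fun i j _ => Subsingleton.elim i j
  have hyy : (Fin.cons (chartBase xx 2 (xx 2)) (fun k => chartGen xx 2 (jJy k).1) :
      Fin 2 → chartRing xx 2) = ![chartBase xx 2 a, chartGen xx 2 1] := by
    ext i
    fin_cases i <;> rfl
  have hy : IsQuasiRegular (![chartBase xx 2 a, chartGen xx 2 1] : Fin 2 → chartRing xx 2) := by
    have h := isQuasiRegular_cons_chartGen xx 2 jJy hx hjJy
    rwa [hyy] at h
  have hBy : IsRegularRing (chartRing xx 2 ⧸ Ideal.span (Set.range
      (![chartBase xx 2 a, chartGen xx 2 1] : Fin 2 → chartRing xx 2))) := by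
    have h := isRegularRing_quot_cons_chartGen xx 2 jJy hx
    rwa [hyy] at h
  -- (C) the strict transform of `V(c)` on `B`: `B/(c′) ≅ B̄′`, a Rees chart over the domain `R/(c)`
  have hjJc : Function.Injective jJc := fun i j _ => Subsingleton.elim i j
  haveI hQcD : IsDomain (R ⧸ Ideal.span (Set.range fun k : Fin 1 => xx (jJc k).1)) := by
    rw [Qc_eq]; exact hcD
  obtain ⟨Θc, hΘc, hΘcbase, hΘcgen⟩ :=
    ChartStrictTransform.exists_strictTransformHom xx embc 1 jJc hx hjJc covc
  -- `B̄′` is a domain (Rees chart of the domain `R/(c)` at `ā ≠ 0`)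
  have hab0 : (fun k : Fin 2 => Ideal.Quotient.mk (Ideal.span (Set.range fun k : Fin 1 => xx (jJc k).1))
      (xx (embc k))) 1 ≠ 0 := by
    have hca' : Ideal.Quotient.mk (Ideal.span (Set.range fun k : Fin 1 => xx (jJc k).1)) a ∈
        (R ⧸ Ideal.span (Set.range fun k : Fin 1 => xx (jJc k).1))⁰ := by
      rw [Qc_eq]; exact hca
    exact nonZeroDivisors.ne_zero hca'
  haveI hBbarD : IsDomain (chartRing (fun k : Fin 2 => Ideal.Quotient.mk
      (Ideal.span (Set.range fun k : Fin 1 => xx (jJc k).1)) (xx (embc k))) 1) :=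
    isDomain_chartRing _ 1 hab0
  -- hence `B/(c′)` is a domain, and `t̄′`, `ā` are non-zero-divisors there
  haveI hBcD : IsDomain (chartRing xx 2 ⧸ Ideal.span {chartGen xx 2 1}) := by
    have h := Function.Injective.isDomain Θc hΘc.1
    rw [EJc_eq] at h
    exact h
  have htbar : Ideal.Quotient.mk (Ideal.span (Set.range fun k : Fin 1 => xx (jJc k).1)) t ∈
      (R ⧸ Ideal.span (Set.range fun k : Fin 1 => xx (jJc k).1))⁰ := by
    rw [Qc_eq]; exact hct
  have hTbar : Ideal.Quotient.mk (Ideal.span {chartGen xx 2 1}) (chartGen xx 2 0) ∈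
      (chartRing xx 2 ⧸ Ideal.span {chartGen xx 2 1})⁰ := by
    -- `ā/1 · (t̄/ā) = t̄/1` is a non-zero-divisor of `B̄′`, hence so is the chart generator `t̄/ā`
    have hprod := reesChartBase_mem_nonZeroDivisors_of_mem_nonZeroDivisors
      (I := Ideal.span (Set.range (fun k : Fin 2 => Ideal.Quotient.mk
        (Ideal.span (Set.range fun k : Fin 1 => xx (jJc k).1)) (xx (embc k)))))
      ((fun k : Fin 2 => Ideal.Quotient.mk (Ideal.span (Set.range fun k : Fin 1 => xx (jJc k).1))
        (xx (embc k))) 1) (Ideal.mem_span_range_self (x := 1)) htbar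
    have cb : chartBase (fun k : Fin 2 => Ideal.Quotient.mk
        (Ideal.span (Set.range fun k : Fin 1 => xx (jJc k).1)) (xx (embc k))) 1
        ((fun k : Fin 2 => Ideal.Quotient.mk (Ideal.span (Set.range fun k : Fin 1 => xx (jJc k).1))
          (xx (embc k))) 0) =
        chartBase _ 1 ((fun k : Fin 2 => Ideal.Quotient.mk
          (Ideal.span (Set.range fun k : Fin 1 => xx (jJc k).1)) (xx (embc k))) 1) * chartGen _ 1 0 :=
      reesChartBase_apply_eq_mul_chartGen _ 1 0
    have hprod' : chartBase (fun k : Fin 2 => Ideal.Quotient.mk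
        (Ideal.span (Set.range fun k : Fin 1 => xx (jJc k).1)) (xx (embc k))) 1
        ((fun k : Fin 2 => Ideal.Quotient.mk (Ideal.span (Set.range fun k : Fin 1 => xx (jJc k).1))
          (xx (embc k))) 0) ∈ _⁰ := hprod
    rw [cb] at hprod'
    have hgen := CuspMember.mem_nonZeroDivisors_of_mul_mem hprod'
    rw [← hΘcgen 0] at hgen
    have h := _root_.mem_nonZeroDivisors_of_injective hΘc.1 hgen
    rw [EJc_eq] at h
    exact h
  have hAbar : Ideal.Quotient.mk (Ideal.span {chartGen xx 2 1}) (chartBase xx 2 a) ∈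
      (chartRing xx 2 ⧸ Ideal.span {chartGen xx 2 1})⁰ := by
    rw [← EJc_eq]
    have hca' : Ideal.Quotient.mk (Ideal.span (Set.range fun k : Fin 1 => xx (jJc k).1)) a ∈
        (R ⧸ Ideal.span (Set.range fun k : Fin 1 => xx (jJc k).1))⁰ := by
      rw [Qc_eq]; exact hca
    exact ChartStrictTransform.mk_chartBase_mem_nonZeroDivisors xx embc 1 jJc hx hjJc covc hca'
  -- (D) the `a`-chart `B₀` of the surface step: transport along `B₀/(c″) ≅ B/(c′)`
  haveI hB0D : IsDomain (chartRing (![chartBase xx 2 a, chartGen xx 2 1] : Fin 2 → chartRing xx 2) 0) :=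
    isDomain_chartRing _ 0 hA0
  obtain ⟨e, he⟩ := exists_strictEquiv (chartBase xx 2 a) (chartGen xx 2 1) hy hAbar
  have hC''0 : chartGen (![chartBase xx 2 a, chartGen xx 2 1] : Fin 2 → chartRing xx 2) 0 1 ≠ 0 := by
    intro h0
    apply hC'0
    have cb' : chartBase (![chartBase xx 2 a, chartGen xx 2 1] : Fin 2 → chartRing xx 2) 0 (chartGen xx 2 1) =
        chartBase (![chartBase xx 2 a, chartGen xx 2 1]) 0 (chartBase xx 2 a) *
          chartGen (![chartBase xx 2 a, chartGen xx 2 1]) 0 1 :=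
      reesChartBase_apply_eq_mul_chartGen (![chartBase xx 2 a, chartGen xx 2 1]) 0 1
    have hcz : chartBase (![chartBase xx 2 a, chartGen xx 2 1] : Fin 2 → chartRing xx 2) 0 (chartGen xx 2 1) = 0 := by
      rw [cb', h0]
      exact mul_zero (chartBase (![chartBase xx 2 a, chartGen xx 2 1] : Fin 2 → chartRing xx 2) 0 (chartBase xx 2 a))
    by_contra hne
    have hnzd := reesChartBase_mem_nonZeroDivisors_of_mem_nonZeroDivisors
      (I := Ideal.span (Set.range (![chartBase xx 2 a, chartGen xx 2 1] : Fin 2 → chartRing xx 2)))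
      ((![chartBase xx 2 a, chartGen xx 2 1] : Fin 2 → chartRing xx 2) 0)
      (Ideal.mem_span_range_self (x := 0)) (mem_nonZeroDivisors_of_ne_zero hne)
    exact nonZeroDivisors.ne_zero hnzd hcz
  have hx₀ := isQuasiRegular_lift (chartGen xx 2 0) (chartBase xx 2 a) (chartGen xx 2 1) e he
    (nonZeroDivisors.ne_zero hTbar) hC''0
  have hR₀ := isRegularRing_quot_lift (chartGen xx 2 0) (chartBase xx 2 a) (chartGen xx 2 1) e he h2'
  exact isRegular_of_isBlowup_surfaceStep (chartGen xx 2 0) (chartGen xx 2 1) (chartBase xx 2 a)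
    hy hBy hx₀ hR₀ hρ

/-- **THE RING-LEVEL TOWER THEOREM for the depth-four member.**  Under the hypotheses of
`isRegular_aChart`, every blowing up of `Spec R` along `F(t, c, a) · (t, c, a)` — `F` the `y`-chart
product `P · Σ · K · ∏_{k<6} B_{k+2}` of the member `(x₃² + x₀³) + 𝔪⁶` and of its ten
`S`-avatars — is a regular scheme (`depthFour_of_aChart`, part 1b, + `isRegular_aChart`).
[cite: StacksProject, Tag 080A] [cite: Liu2002, Thm. 8.1.19 (a)] -/
theorem depthFour_isRegular' [IsRegularRing R] [IsDomain R]
    (hw : RingTheory.Sequence.IsWeaklyRegular R [t, c, a])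
    (h3 : IsRegularRing (R ⧸ (Ideal.span {t} ⊔ Ideal.span {c} ⊔ Ideal.span {a})))
    (h2 : IsRegularRing (R ⧸ (Ideal.span {t} ⊔ Ideal.span {c})))
    (hcD : IsDomain (R ⧸ Ideal.span {c}))
    (hct : Ideal.Quotient.mk (Ideal.span {c}) t ∈ (R ⧸ Ideal.span {c})⁰)
    (hca : Ideal.Quotient.mk (Ideal.span {c}) a ∈ (R ⧸ Ideal.span {c})⁰) (hc0 : c ≠ 0)
    {Y : Scheme.{u}} {f : Y ⟶ Spec (.of R)}
    (hf : IsBlowup f (affineBlowup.idealSheaf (Ff[t,c,a] * Ideal.span (Set.range xx)))) :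
    Scheme.IsRegular Y :=
  depthFour_of_aChart t c a hw h3 (isRegular_aChart' t c a hw h3 h2 hcD hct hca hc0) hf

end Persistence

end CuspDepthFour

end Summit.ResolutionOfSingularities.ResolutionOfSingularities.Theorems

end
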